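import Mathlib.NumberTheory.LegendreSymbol.JacobiSymbol
import Mathlib.Tactic.NormNum.LegendreSymbol
import Literature.NumberTheory.EllipticCurves.Smith2016.CongruentNumberBSDSelmerRankTwoProofs
import Literature.NumberTheory.EllipticCurves.SelmerCorankHolds
import HarnessLib

/-!
# Monsky 1990, *Mock Heegner Points and Congruent Numbers* (Math. Z. 204), Cor. 5.15 with Remark (2) AS PRINTED — rank EXACTLY one and `2`-Selmer rank one for twelve explicit prime / two-prime families of congruent number curves

HONEST FRAMING (cell `b2b-bsdres`, sub-lane `bsd-p2`, `run/shared/lean/b2b/bsd-rank1-residual/p2/`;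
literature typer 2, row T2-L2 of `p2/LIT-STATUS-typer2.md` §L; the want `acq-09908` of the Monsky
sub-cell): ONE published, refereed theorem vendored as a named `Prop` (nothing asserted, nothing
discharged; D-0014), every printed hypothesis a binder (the family membership is an explicit,
decidable-in-principle predicate), locators into the OPEN digitization read for this file; plus
bookkeeping PROVED from tree theorems. It is a statement about Mordell–Weil rank and the `2`-Selmer
group — NOTHING analytic: the paper proves no `L`-value / Gross–Zagier relation for its "mock
Heegner points" and makes no BSD₂ claim (BSD enters only as "predicts", p. 45). EVIDENCE of what
print says `2`-adically for twelve RANK-ONE congruent-number families; nothing booked; no mark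
moved.

Source. P. Monsky, *Mock Heegner Points and Congruent Numbers*, Math. Z. **204** (1990) 45–67
[Monsky1990MockHeegner] (received 5 Sept. 1988). Text read: the open digitization of the
Göttinger Digitalisierungszentrum (PPN266833020_0204, LOG_0009; the PDF is image-only, lit key
`paper:url-3b4594f0fd7a`; the statements below were transcribed from the page IMAGES, the
word-level OCR `…/fulltext/PPN266833020_0204/000000NN.xml` serving only as a finder); verbatim
transcript with page numbers in `p2/lit/MONSKY1990-AS-PRINTED.md` (sha16 077aea48a7d370b1).
Locators `p. NN` are JOURNAL pages.

## The printed statements (verbatim)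

Notation (p. 45): "Let `N` be a square-free positive integer and `E^{(N)}` be the elliptic curve
defined by `NV² = U³ − U`. … Suppose now and for the rest of this paper that `N ≡ 5, 6` or
`7 (8)`." `p₁, p₃, p₅` and `p₇` "denote primes `≡ 1, 3, 5` and `7 (8)`"; a primed letter
(`p′₃`, `p′₅`) is a second prime of the same class. `E : V² = U³ − U` (conductor `32`),
`C : 2Y² = X⁴ + 1 ≅_ℚ E`; `K = ℚ(i√(NN*))` with `N*` auxiliary square-free, `≡ 1, 2, 3 (8)`,
`N* ≢ N (2)`, `(N*, N) = 1`, `D = NN*/2` (p. 46) — `2` RAMIFIES in `K` ("mock" Heegner points);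
`Λ_N ⊂ C` "is isomorphic to the group of `ℚ`-rational points of `E^{(N)}`" (Lemma 3.3 (2), p. 53),
`T` = the `2`-division points, `S_N = Σ_{𝒜 ∈ G_N} P_𝒜` (Def. 3.4, p. 53).

* **Theorem 5.13** (pp. 65–66): "In each of the following cases `2S_N` is in `Λ_N` but not in
  `2Λ_N + T`. (1) `N = p₅, N* = 2`, (2) `N = 2p₃, N* = 1`, (3) `N = p₇, N* = 2`, (4) `N = 2p₇,
  N* = 1`."
* **Theorem 5.14** (p. 66): "In each of the following cases `S_N` is in `Λ_N` but not in
  `2Λ_N + T`. (5) `N = 2p₃, N* = p′₃`, (6) `N = p₅, N* = 2p′₅`, (7) `N = p₃p₇, N* = 2`,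
  (8) `N = 2p₇, N* = p₃`, (9) `N = p₁p₅, N* = 2`, provided `(p₁/p₅) = −1`, (10) `N = 2p₁p₇,
  N* = 1`, provided `(p₁/p₇) = −1`, (11) `N = p₁p₇, N* = 2`, provided `(p₁/p₇) = −1`,
  (12) `N = p₃p₅, N* = 2`, (13) `N = 2p₃p₅, N* = 1`, (14) `N = 2p₁p₃, N* = 1`, provided
  `(p₁/p₃) = −1`, (15) `N = 2p₅p₇, N* = 1`, (16) `N = p₇, N* = 2p₅`."
* **Corollary 5.15** (p. 66): "The following are all congruent numbers: (1) `p₅, p₇, 2p₇` and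
  `2p₃`, (2) `p₃p₇, p₃p₅, 2p₃p₅` and `2p₅p₇`, (3) `p₁p₅` when `(p₁/p₅) = −1`, `p₁p₇` and `2p₁p₇`
  when `(p₁/p₇) = −1`, `2p₁p₃` when `(p₁/p₃) = −1`."
* Lemma 3.3 (3) and the Remark after it (p. 53): "If `P ∈ Λ_N`, `P ∉ T`, then `P` has infinite
  order and `N` is a 'congruent number'. … Suppose that `P` is as in (3) of Lemma 3.3 and that
  `E^{(N)}_ℚ` has rank `≤ 1`. Then `E^{(N)}_ℚ` has rank `1`, and `P` and `T` generate a subgroup of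
  `Λ_N` of finite index. If in addition `P ∉ 2Λ_N + T` then this index is necessarily odd."
* Remarks (1)–(2) (pp. 66–67): "(1) Let `S̄` be the quotient of the Selmer group for the
  multiplication by `2` isogeny `E^{(N)} → E^{(N)}` by the image of the `2`-torsion subgroup of
  `E^{(N)}`. … It is known that `S̄` has odd dimension and that `S̄*` has even dimension. …
  **(2)** … Suppose for example that `D` has `1` or `2` prime factors. The very patient reader may
  verify that `S̄ = ℤ/2` and `S̄* = (0)` precisely when we are in one of the 16 cases listed in
  Theorems 5.13 and 5.14. In these cases we've shown that the rank of `E^{(N)}_ℚ` is `≥ 1`; since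
  the rank is bounded by `dim S̄ = 1`, it is exactly one. The remark after Lemma 3.3 now shows that
  in the cases of Theorem 5.13 the subgroup of `Λ_N` generated by `2S_N` and `T` is of odd index,
  while the same is true of the subgroup generated by `S_N` and `T` in the cases of Theorem 5.14."
  (Also p. 46: "For the `N` in (1), (2) and (3) above our proof shows that `E^{(N)}_ℚ` has rank
  `1`. … This need no longer be true when `N = pq` or `2pq` with `p ≡ 1 (8)` and `(p/q) = 1`. For
  example, when `N = (521)·(5)`, `E^{(N)}_ℚ` has rank `3`.")
* NOT vendored: Remark (3) (p. 67) — "We **suspect** that `S_N` has infinite order … and that `S_N`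
  is divisible by `2^{ℓ−2}`, but not by `2^{ℓ−1}`, in `Λ_N/T`" — a CONJECTURE as printed (not
  Literature); and the odd-index clauses of Remark (2), whose object `S_N` (a level-`8` modular
  parametrisation `X, Y` of `C`) has no tree counterpart.

## What is typed, and the `p = 2` flag

ONE named fact, `cor515_rank_eq_one_and_card_selmerGroup_two`: for `N` in the twelve families of
Cor. 5.15 (= the `N` occurring in the sixteen cases of Thms. 5.13/5.14), `rank E^{(N)}(ℚ) = 1`
EXACTLY (Remark (2) with p. 46) and `S̄ = ℤ/2`, i.e. `#Sel^{(2)}(E^{(N)}/ℚ) = 8 = 2^{2+1}`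
(Heath-Brown's `s(N) = 1`; the image of `E^{(N)}(ℚ)[2] ≅ (ℤ/2)²` in `Sel^{(2)}` has order `4`
because `E^{(N)}(ℚ)_tors = ℤ/2 × ℤ/2`, p. 45). The `S̄`-clause is printed with its verification
"left to the very patient reader" — flagged as such; it is independently the `𝔽₂`-rank statement
of Monsky's 1994 matrix (tree: `HeathBrown1994/CongruentTwoSelmerMonskyMatrix.lean`), which the
sub-cell's engines check `k/k`. No prime is excluded and none is a parameter; all content is
`2`-primary (ALLOWS-2, indeed ABOUT 2). WHAT IT DOES NOT GIVE: `ord_{s=1} L(E^{(N)}, s) = 1` or any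
`2`-part of BSD — to pass from "rank `1` ∧ `Ш[2^∞] = 0`" (proved below from the fact) to the
analytic side one would need a rank-ONE `2`-converse for `j = 1728`, which is not in print
(Burungale–Tian's rank-one `2`-converse is printed for `K = ℚ(√−7)` only; their Ann. of Math. 203
(2026) Thm. 1.1 is the rank-ZERO converse), or the later genuine-Heegner-point route of Tian (2014)
/ Tian–Yuan–Zhang (2017) / Li–Liu–Tian (2024) (tree: `Tian2014`, `TianYuanZhang2017`,
`LiLiuTian2024`), which is where analytic rank and BSD₂ for (sub)families of these `N` are printed.

## Transcription (tree dictionary)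

* `E^{(N)} : NV² = U³ − U` is `ℚ`-isomorphic to the tree's `congruentNumberCurve N : y² = x³ − N²x`
  (`(x, y) = (NU, N²V)`); Mordell–Weil rank and `#Sel^{(2)}` are isomorphism invariants, so the
  fact is stated for `congruentNumberCurve N` exactly as in `Smith2016.cor13_bsd_of_selmerRankTwo`
  and `LiLiuTian2024.thm12_bsd_congruentNumberCurve` (instance binder `[IsElliptic]`, a theorem for
  `N ≠ 0`: `isElliptic_congruentNumberCurve`).
* "`p_i` a prime `≡ i (8)`": `Nat.Prime p ∧ p % 8 = i`; "`(p₁/q) = −1`": Mathlib's Jacobi symbol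
  `jacobiSym p₁ q = -1` (= the Legendre symbol, `q` an odd prime; `norm_num` evaluates it).
* "rank … exactly one": `(congruentNumberCurve N).mordellWeilRank = 1`; "`S̄ = ℤ/2`":
  `Nat.card ((congruentNumberCurve N).selmerGroup 2) = 8` (the tree's `2`-Selmer group
  `⊆ H¹(ℚ, E[2])`, `Selmer.lean`, as in the Smith and Heath-Brown–Monsky files).
No `_holds` expected (level-`8` modular functions, Shimura reciprocity, genus theory of
`ℤ[√−2D]`). Consumers take `(h : cor515_rank_eq_one_and_card_selmerGroup_two)`.

## What is PROVED here (tree/Mathlib theorems only)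

* `IsCor515Family.mod_eight`: every member is `≡ 5, 6` or `7 (mod 8)` (the paper's standing
  hypothesis, p. 45 — so the root number is `−1`, cf. the tree's `isCongruentNumber_of_mod_eight`);
  `IsCor515Family.ne_zero`, `IsCor515Family.squarefree` (products of distinct primes);
* under the named fact, instances discharged: `isCongruentNumber_of_cor515` (Cor. 5.15 literally:
  `IsCongruentNumber N`, via the tree's `isCongruentNumber_of_mordellWeilRank_ne_zero`),
  `primaryComponent_sha_two_eq_bot_of_cor515` (`Ш(E^{(N)}/ℚ)[2^∞] = 0`, from the descent count
  `#Sel^{(2)} = 2^{rank}·#E(ℚ)[2]·#(Ш ⊓ H¹[2])`, Silverman X.4.2, with `rank = 1`, `#E[2] = 4`),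
  and `selmerCorank_two_eq_one_of_cor515` (`corank_{ℤ₂} Sel_{2^∞}(E^{(N)}/ℚ) = 1`, Greenberg's
  corank identity, tree theorem `selmerCorank_eq_mordellWeilRank_add_holds`) — the exact
  hypothesis shape a rank-one `2`-converse would consume;
* a showcase of the membership predicate: `5, 6, 7, 14, 15, 21, 30, 70 ∈` the families, and
  `85 = 17·5` (`(17/5) = −1`), `238 = 2·17·7` (`(17/7) = −1`).

## References
* [Monsky1990MockHeegner] P. Monsky, Math. Z. 204 (1990) 45–67: p. 45 (setting), p. 46 (remark,
  rank-3 example), p. 53 (Lemma 3.3, Remark, Def. 3.4, Thms. 3.5–3.6), pp. 65–66 (Thms. 5.13,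
  5.14, Cor. 5.15), pp. 66–67 (Remarks (1)–(3)).
* [HeathBrown1994SelmerCongruentII] D. R. Heath-Brown (appendix by P. Monsky), Invent. Math. 118
  (1994): `#S^{(2)} = 2^{2+s(D)}` (tree: `HeathBrown1994.monsky_card_selmerGroup_two_odd/even`).
* [SilvermanAEC2009] Thm. X.4.2 (descent count). [Greenberg1999LNM] §1 (corank identity).
-/

noncomputable section

open scoped Classical

open WeierstrassCurve Literature.NumberTheory.EllipticCurves

namespace Literature.NumberTheory.EllipticCurves.Monsky1990

/-! ### §1. The twelve families of Corollary 5.15 (membership predicate, every condition a clause) -/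

/-- **The families of Monsky 1990, Cor. 5.15** (p. 66), `p_i` denoting a prime `≡ i (mod 8)`:
(1) `p₅`, `p₇`, `2p₇`, `2p₃`; (2) `p₃p₇`, `p₃p₅`, `2p₃p₅`, `2p₅p₇`; (3) `p₁p₅` with
`(p₁/p₅) = −1`, `p₁p₇` and `2p₁p₇` with `(p₁/p₇) = −1`, `2p₁p₃` with `(p₁/p₃) = −1` — exactly the
values of `N` occurring in the sixteen cases of Thms. 5.13 and 5.14. The Legendre symbols are
Mathlib's `jacobiSym`. [cite: Monsky1990MockHeegner, Cor. 5.15 (p. 66); (1)–(3) of p. 45] -/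
def IsCor515Family (N : ℕ) : Prop :=
  -- (1) one odd prime: p₅, p₇, 2p₃, 2p₇
  (N.Prime ∧ (N % 8 = 5 ∨ N % 8 = 7)) ∨
  (∃ p : ℕ, p.Prime ∧ (p % 8 = 3 ∨ p % 8 = 7) ∧ N = 2 * p) ∨
  -- (2) two odd primes, no symbol condition: p₃p₇, p₃p₅, 2p₃p₅, 2p₅p₇
  (∃ p q : ℕ, p.Prime ∧ q.Prime ∧ p % 8 = 3 ∧ (q % 8 = 7 ∨ q % 8 = 5) ∧ N = p * q) ∨
  (∃ p q : ℕ, p.Prime ∧ q.Prime ∧ p % 8 = 5 ∧ (q % 8 = 3 ∨ q % 8 = 7) ∧ N = 2 * (p * q)) ∨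
  -- (3) one prime p₁ ≡ 1 (8) and a symbol condition: p₁p₅, p₁p₇, 2p₁p₇, 2p₁p₃
  (∃ p q : ℕ, p.Prime ∧ q.Prime ∧ p % 8 = 1 ∧ (q % 8 = 5 ∨ q % 8 = 7) ∧ jacobiSym p q = -1 ∧
    N = p * q) ∨
  (∃ p q : ℕ, p.Prime ∧ q.Prime ∧ p % 8 = 1 ∧ (q % 8 = 7 ∨ q % 8 = 3) ∧ jacobiSym p q = -1 ∧
    N = 2 * (p * q))

namespace IsCor515Family

/-- `ab mod 8` is determined by `a mod 8` and `b mod 8` (plumbing for `mod_eight`). [folklore] -/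
private lemma mul_mod_eight (a b : ℕ) : (a * b) % 8 = ((a % 8) * (b % 8)) % 8 := Nat.mul_mod a b 8

/-- Every member of the Cor. 5.15 families is `≡ 5, 6` or `7 (mod 8)` — the paper's standing
hypothesis "Suppose now and for the rest of this paper that `N ≡ 5, 6` or `7 (8)`" (so the
`L`-function of `E^{(N)}` has odd order at `s = 1`). PROVED by residue arithmetic.
[cite: Monsky1990MockHeegner, p. 45] -/
theorem mod_eight {N : ℕ} (h : IsCor515Family N) : N % 8 = 5 ∨ N % 8 = 6 ∨ N % 8 = 7 := by
  rcases h with ⟨-, h8⟩ | ⟨p, -, hp, rfl⟩ | ⟨p, q, -, -, hp, hq, rfl⟩ | ⟨p, q, -, -, hp, hq, rfl⟩ |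
      ⟨p, q, -, -, hp, hq, -, rfl⟩ | ⟨p, q, -, -, hp, hq, -, rfl⟩
  · omega
  · rw [mul_mod_eight]; omega
  · rw [mul_mod_eight]; rcases hq with hq | hq <;> simp [hp, hq]
  · rw [mul_mod_eight, mul_mod_eight p]; rcases hq with hq | hq <;> simp [hp, hq]
  · rw [mul_mod_eight]; rcases hq with hq | hq <;> simp [hp, hq]
  · rw [mul_mod_eight, mul_mod_eight p]; rcases hq with hq | hq <;> simp [hp, hq]

/-- Members are non-zero ("`N` … a square-free positive integer", p. 45), so `congruentNumberCurve N`
is elliptic (`isElliptic_congruentNumberCurve`). [cite: Monsky1990MockHeegner, p. 45 and Cor. 5.15 (p. 66)] -/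
theorem ne_zero {N : ℕ} (h : IsCor515Family N) : N ≠ 0 := by
  rintro rfl
  rcases mod_eight h with h | h | h <;> simp at h

/-- Members are square-free ("`N` … a square-free positive integer", p. 45): they are products of
distinct primes (distinct residues mod `8`). PROVED (`Nat.squarefree_mul_iff`, coprimality of
distinct primes) so that consumers can feed the tree's `Squarefree`-guarded lemmas on
`congruentNumberCurve N`. [cite: Monsky1990MockHeegner, p. 45 and Cor. 5.15 (p. 66)] -/
theorem squarefree {N : ℕ} (h : IsCor515Family N) : Squarefree N := by
  -- two distinct primes are coprime; `2` is coprime to every odd prime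
  have cop : ∀ {a b : ℕ}, a.Prime → b.Prime → a ≠ b → a.Coprime b :=
    fun ha hb hab => (Nat.coprime_primes ha hb).mpr hab
  have sqpq : ∀ {a b : ℕ}, a.Prime → b.Prime → a ≠ b → Squarefree (a * b) :=
    fun ha hb hab => Nat.squarefree_mul_iff.mpr ⟨cop ha hb hab, ha.prime.squarefree, hb.prime.squarefree⟩
  rcases h with ⟨hN, -⟩ | ⟨p, hp, hp8, rfl⟩ | ⟨p, q, hp, hq, hp8, hq8, rfl⟩ |
      ⟨p, q, hp, hq, hp8, hq8, rfl⟩ | ⟨p, q, hp, hq, hp8, hq8, -, rfl⟩ | ⟨p, q, hp, hq, hp8, hq8, -, rfl⟩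
  · exact hN.prime.squarefree
  · exact sqpq Nat.prime_two hp (by omega)
  · exact sqpq hp hq (by omega)
  · refine Nat.squarefree_mul_iff.mpr ⟨?_, Nat.prime_two.prime.squarefree, sqpq hp hq (by omega)⟩
    exact Nat.Coprime.mul_right (cop Nat.prime_two hp (by omega)) (cop Nat.prime_two hq (by omega))
  · exact sqpq hp hq (by omega)
  · refine Nat.squarefree_mul_iff.mpr ⟨?_, Nat.prime_two.prime.squarefree, sqpq hp hq (by omega)⟩
    exact Nat.Coprime.mul_right (cop Nat.prime_two hp (by omega)) (cop Nat.prime_two hq (by omega))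

end IsCor515Family

/-! ### §2. The named fact: Cor. 5.15 with Remark (2) — rank exactly one and `S̄ = ℤ/2` -/

/-- **Monsky 1990, Cor. 5.15 with Remark (2)** (verbatim in the module docstring): for every `N`
in the twelve families of Cor. 5.15, "`E^{(N)}_ℚ` … rank … is exactly one" (Remark (2), p. 67;
p. 46 "our proof shows that `E^{(N)}_ℚ` has rank `1`") and "`S̄ = ℤ/2`" (Remark (2): `S̄` = the
`2`-Selmer group of `E^{(N)}/ℚ` modulo the image of `E^{(N)}(ℚ)[2] ≅ (ℤ/2)²`, so
`#Sel^{(2)}(E^{(N)}/ℚ) = 8`; printed with its verification "left to the very patient reader", and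
equal to the `𝔽₂`-rank statement of Monsky's 1994 matrix). A THEOREM of the source (mock Heegner
points over `ℚ(i√(NN*))`, `2` ramified; Thms. 5.13/5.14 + Lemma 3.3), vendored as a named fact on
the tree's model `congruentNumberCurve N : y² = x³ − N²x ≅_ℚ (NV² = U³ − U)`. Purely algebraic: no
`L`-value, no BSD₂ content. No `_holds` expected.
[cite: Monsky1990MockHeegner, Cor. 5.15 (p. 66), Remark (2) (p. 67), Remark p. 46, Thms. 5.13–5.14 (pp. 65–66)] -/
def cor515_rank_eq_one_and_card_selmerGroup_two : Prop :=
  ∀ (N : ℕ) [(congruentNumberCurve N).IsElliptic], IsCor515Family N →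
    (congruentNumberCurve N).mordellWeilRank = 1 ∧
      Nat.card ((congruentNumberCurve N).selmerGroup 2) = 8

/-! ### §3. Consequences of the named fact (instances discharged; tree theorems only) -/

/-- **Cor. 5.15 literally** — "The following are all congruent numbers": under the named fact every
member `N` is a congruent number in the tree's sense (`IsCongruentNumber N`: a rational right
triangle of area `N`), via rank `1 ≠ 0` and the tree's
`isCongruentNumber_of_mordellWeilRank_ne_zero` (Top–Yui Prop. 3.3).
[cite: Monsky1990MockHeegner, Cor. 5.15 (p. 66); Lemma 3.3 (3) (p. 53)] -/
theorem isCongruentNumber_of_cor515 (h : cor515_rank_eq_one_and_card_selmerGroup_two)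
    {N : ℕ} (hN : IsCor515Family N) : IsCongruentNumber N := by
  haveI := isElliptic_congruentNumberCurve hN.ne_zero
  have hr := (h N hN).1
  exact isCongruentNumber_of_mordellWeilRank_ne_zero hN.ne_zero (by rw [hr]; exact one_ne_zero)

/-- **`Ш(E^{(N)}/ℚ)[2^∞] = 0` for the Cor. 5.15 families** (under the named fact): the descent count
`#Sel^{(2)} = 2^{rank} · #E(ℚ)[2] · #(Ш ⊓ H¹(ℚ,E)[2])` (`WeierstrassCurve.natCard_selmerGroup_eq`,
Silverman X.4.2(a)) with `rank = 1`, `#E^{(N)}(ℚ)[2] = 4`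
(`Smith2016.natCard_torsionBy_two_congruentNumberCurve`) and `#Sel^{(2)} = 8` leaves `#Ш[2] = 1`,
and a `2`-primary group without `2`-torsion is trivial
(`primaryComponent_sha_eq_bot_of_inf_torsionBy_eq_bot`). The one-line consequence
"`dim S̄ = rank + dim Ш[2]`" of Remark (2), not printed as such.
[cite: Monsky1990MockHeegner, Remark (2) (p. 67)] [cite: SilvermanAEC2009, Thm. X.4.2] -/
theorem primaryComponent_sha_two_eq_bot_of_cor515 (h : cor515_rank_eq_one_and_card_selmerGroup_two)
    {N : ℕ} (hN : IsCor515Family N) :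
    haveI := isElliptic_congruentNumberCurve hN.ne_zero
    AddCommGroup.primaryComponent (congruentNumberCurve N).sha 2 = ⊥ := by
  have hn := hN.ne_zero
  haveI := isElliptic_congruentNumberCurve hn
  haveI : Fact (Nat.Prime 2) := ⟨Nat.prime_two⟩
  obtain ⟨hr, hsel8⟩ := h N hN
  have hsel : Nat.card ((congruentNumberCurve N).selmerGroup ((2 : ℕ) : ℤ)) = 8 := by
    simpa only [Nat.cast_ofNat] using hsel8
  -- the descent count `#Sel^(2) = 2^rank · #E(ℚ)[2] · #(Ш ⊓ H¹(ℚ,E)[2])` (Silverman X.4.2(a))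
  have hcard := (congruentNumberCurve N).natCard_selmerGroup_eq (n := 2) two_ne_zero
  rw [hsel, hr, pow_one] at hcard
  -- `8 = 2 · #E(ℚ)[2] · #(Ш ⊓ H¹(ℚ,E)[2])` with `#E(ℚ)[2] = 4`; the generic count carries the classical
  -- `DecidableEq` on the base field inside `E(ℚ)`, bridged by `convert` (a subsingleton)
  have aux : ∀ {T S : ℕ}, 8 = 2 * T * S → T = 4 → S = 1 := by
    intro T S hTS hT
    subst hT
    omega
  have hone := aux hcard
    (by convert Smith2016.natCard_torsionBy_two_congruentNumberCurve hn; norm_num)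
  exact primaryComponent_sha_eq_bot_of_inf_torsionBy_eq_bot (congruentNumberCurve N) 2
    (AddSubgroup.eq_bot_of_card_eq _ hone)

/-- **`corank_{ℤ₂} Sel_{2^∞}(E^{(N)}/ℚ) = 1` for the Cor. 5.15 families** (under the named fact):
Greenberg's corank identity `corank Sel_{p^∞} = rank + corank Ш[p^∞]` (tree theorem
`selmerCorank_eq_mordellWeilRank_add_holds`) with rank `1` and `Ш[2^∞] = 0` (finite, so corank
`0`: `finite_primaryComponent_sha_iff_shaCorank_eq_zero`). This is exactly the hypothesis a
rank-ONE `2`-converse theorem would consume; no such converse is in print for `j = 1728`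
(module docstring), so nothing analytic follows here.
[cite: Monsky1990MockHeegner, Remark (2) (p. 67)] [cite: Greenberg1999LNM, §1 pp. 54–57] -/
theorem selmerCorank_two_eq_one_of_cor515 (h : cor515_rank_eq_one_and_card_selmerGroup_two)
    {N : ℕ} (hN : IsCor515Family N) :
    haveI := isElliptic_congruentNumberCurve hN.ne_zero
    haveI : Fact (Nat.Prime 2) := ⟨Nat.prime_two⟩
    (congruentNumberCurve N).selmerCorank 2 = 1 := by
  have hn := hN.ne_zero
  haveI := isElliptic_congruentNumberCurve hn
  haveI : Fact (Nat.Prime 2) := ⟨Nat.prime_two⟩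
  have hr := (h N hN).1
  have hbot := primaryComponent_sha_two_eq_bot_of_cor515 h hN
  have hfin : Finite (AddCommGroup.primaryComponent (congruentNumberCurve N).sha 2) := by
    rw [hbot]; infer_instance
  simp only [(congruentNumberCurve N).selmerCorank_eq_mordellWeilRank_add_holds 2, hr,
    (finite_primaryComponent_sha_iff_shaCorank_eq_zero (congruentNumberCurve N) 2).1 hfin]

/-! ### §4. Showcase: membership of the printed families is explicit -/

/-- `5 = p₅` is in the families (group (1) of Cor. 5.15). [cite: Monsky1990MockHeegner, Cor. 5.15 (1) (p. 66)] -/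
theorem isCor515Family_five : IsCor515Family 5 := Or.inl ⟨by norm_num, by norm_num⟩

/-- `7 = p₇` (group (1) of Cor. 5.15). [cite: Monsky1990MockHeegner, Cor. 5.15 (1) (p. 66)] -/
theorem isCor515Family_seven : IsCor515Family 7 := Or.inl ⟨by norm_num, by norm_num⟩

/-- `6 = 2p₃` (group (1) of Cor. 5.15). [cite: Monsky1990MockHeegner, Cor. 5.15 (1) (p. 66)] -/
theorem isCor515Family_six : IsCor515Family 6 := Or.inr (Or.inl ⟨3, by norm_num, by norm_num, rfl⟩)

/-- `14 = 2p₇` (group (1) of Cor. 5.15). [cite: Monsky1990MockHeegner, Cor. 5.15 (1) (p. 66)] -/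
theorem isCor515Family_fourteen : IsCor515Family 14 :=
  Or.inr (Or.inl ⟨7, by norm_num, by norm_num, rfl⟩)

/-- `21 = p₃p₇` (group (2) of Cor. 5.15). [cite: Monsky1990MockHeegner, Cor. 5.15 (2) (p. 66)] -/
theorem isCor515Family_twentyone : IsCor515Family 21 :=
  Or.inr (Or.inr (Or.inl ⟨3, 7, by norm_num, by norm_num, by norm_num, by norm_num, rfl⟩))

/-- `15 = p₃p₅` (group (2) of Cor. 5.15). [cite: Monsky1990MockHeegner, Cor. 5.15 (2) (p. 66)] -/
theorem isCor515Family_fifteen : IsCor515Family 15 :=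
  Or.inr (Or.inr (Or.inl ⟨3, 5, by norm_num, by norm_num, by norm_num, by norm_num, rfl⟩))

/-- `30 = 2p₃p₅` (group (2) of Cor. 5.15). [cite: Monsky1990MockHeegner, Cor. 5.15 (2) (p. 66)] -/
theorem isCor515Family_thirty : IsCor515Family 30 :=
  Or.inr (Or.inr (Or.inr (Or.inl ⟨5, 3, by norm_num, by norm_num, by norm_num, by norm_num, rfl⟩)))

/-- `70 = 2p₅p₇` (group (2) of Cor. 5.15). [cite: Monsky1990MockHeegner, Cor. 5.15 (2) (p. 66)] -/
theorem isCor515Family_seventy : IsCor515Family 70 :=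
  Or.inr (Or.inr (Or.inr (Or.inl ⟨5, 7, by norm_num, by norm_num, by norm_num, by norm_num, rfl⟩)))

/-- `85 = 17·5 = p₁p₅` with `(17/5) = −1` (group (3) of Cor. 5.15; the Jacobi symbol is evaluated by
`norm_num`). [cite: Monsky1990MockHeegner, Cor. 5.15 (3) (p. 66)] -/
theorem isCor515Family_eightyfive : IsCor515Family 85 :=
  Or.inr (Or.inr (Or.inr (Or.inr (Or.inl
    ⟨17, 5, by norm_num, by norm_num, by norm_num, by norm_num, by norm_num [jacobiSym], rfl⟩))))

/-- `238 = 2·17·7 = 2p₁p₇` with `(17/7) = −1` (group (3) of Cor. 5.15). [cite: Monsky1990MockHeegner, Cor. 5.15 (3) (p. 66)] -/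
theorem isCor515Family_238 : IsCor515Family 238 :=
  Or.inr (Or.inr (Or.inr (Or.inr (Or.inr
    ⟨17, 7, by norm_num, by norm_num, by norm_num, by norm_num, by norm_num [jacobiSym], rfl⟩))))

/-- Showcase consequence: modulo the one named fact, `Ш(E^{(5)}/ℚ)[2^∞] = 0` and
`corank_{ℤ₂} Sel_{2^∞}(E^{(5)}/ℚ) = 1` for `y² = x³ − 25x` (`N = 5 = p₅`).
[cite: Monsky1990MockHeegner, Remark (2) (p. 67) with Cor. 5.15 (1)] -/
theorem selmerCorank_two_congruentNumberCurve_five (h : cor515_rank_eq_one_and_card_selmerGroup_two) :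
    haveI := isElliptic_congruentNumberCurve (show (5 : ℕ) ≠ 0 by norm_num)
    haveI : Fact (Nat.Prime 2) := ⟨Nat.prime_two⟩
    (congruentNumberCurve 5).selmerCorank 2 = 1 :=
  selmerCorank_two_eq_one_of_cor515 h isCor515Family_five

end Literature.NumberTheory.EllipticCurves.Monsky1990

end
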